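import Summits.NavierStokesRegularity.NavierStokesRegularity.Theorems.QuantisedSymmetryPolyhedralDssProfileExistsStubIsotropicMoments
import Literature.Analysis.FluidPDE.WholeSpaceIBPIntegrable
import Literature.Analysis.FluidPDE.PineauVicolWeightedIdentity
import HarnessLib

/-!
# Crux `PolyhedralDssProfileExists` (stmt-NavierStokesRegularity-1404), line `polyhedral_cell` —
# stub `stub_firstMomentsVanish` (Schur on `ℝ³ ⊗ ℝ³`: the Gaussian first moments vanish)

Let `G` be a group of linear isometries of `ℝ³ = EuclideanSpace ℝ (Fin 3)` acting irreducibly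
(every `G`-invariant subspace is `⊥` or `⊤`) and let `w : ℝ³ → ℝ³` be `C¹`, bounded,
divergence free and `G`-equivariant, `w (g x) = g (w x)`. Then every Gaussian-weighted first
moment vanishes: `∫ e^{−‖x‖²} ⟪a, x⟫ ⟪b, w x⟫ dx = 0` for all `a b`.

Proof: the moment operator `T b = ∫ (e^{−‖x‖²} ⟪b, w x⟫) • x dx` (a Bochner integral; the
integrand is dominated by `‖b‖ M ‖x‖ e^{−‖x‖²}`) is linear, represents the moment form
(`⟪a, T b⟫ = ∫ e^{−‖x‖²} ⟪a, x⟫ ⟪b, w x⟫`) and commutes with `G` (change of variables `x = g y`: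
`g` preserves Lebesgue measure, `‖g y‖ = ‖y‖`, `⟪g b, g (w y)⟫ = ⟪b, w y⟫`, and `g` commutes with
the Bochner integral). Its trace over an orthonormal basis is
`∑ i, ⟪e i, T (e i)⟫ = ∫ e^{−‖x‖²} ⟪x, w x⟫ dx = −½ ∫ ⟪w, ∇ e^{−‖·‖²}⟫ = ½ ∫ e^{−‖x‖²} div w = 0`
by the whole-space integration by parts in `L¹` form
(`integral_mul_divergence_add_eq_zero_of_integrable`, `WholeSpaceIBPIntegrable.lean`: only
`e^{−‖x‖²} w`, `e^{−‖x‖²} div w = 0` and `⟪w, ∇e^{−‖x‖²}⟫ = −2 e^{−‖x‖²} ⟪x, w x⟫` need to be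
integrable, which boundedness of `w` provides — no bound on `Dw` is used). By the real Schur
lemma in the trace-free form (`schurJet_eq_zero_of_comm_of_trace_eq_zero`, Serre, *Linear
Representations of Finite Groups*, §13.2; bib `SerreLinearRepresentations1977`) `T = 0`, whence
`⟪a, T b⟫ = 0`. All other ingredients are Mathlib (`LinearIsometryEquiv.measurePreserving`,
`MeasurePreserving.integral_comp`, `ContinuousLinearEquiv.integral_comp_comm`, `integral_inner`,
`OrthonormalBasis.sum_inner_mul_inner`, `LinearMap.trace_eq_sum_inner`) and the tree's
Gaussian calculus (`gaussProfile`, `fderiv_gaussProfile_apply`,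
`PineauVicol2026.integrable_one_add_norm_pow_mul_exp_neg_mul_sq`).
-/

noncomputable section

open MeasureTheory Set Function Filter Topology
open Literature.Analysis Literature.Analysis.FluidPDE
open scoped InnerProductSpace RealInnerProductSpace

-- the summit namespace …NavierStokesRegularity.NavierStokesRegularity… is the tree convention (D-0017)
set_option linter.dupNamespace false

namespace Summit.NavierStokesRegularity.NavierStokesRegularity.Theorems.PolyhedralDssProfileExists.PolyhedralCell

variable {w : EuclideanSpace ℝ (Fin 3) → EuclideanSpace ℝ (Fin 3)} {M : ℝ}

/-- **The Gaussian weight is continuous**: `x ↦ e^{−‖x‖²}` is continuous on `ℝ³`. [folklore] -/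
theorem firstMom_continuous_exp :
    Continuous fun x : EuclideanSpace ℝ (Fin 3) => Real.exp (-‖x‖ ^ 2) :=
  Real.continuous_exp.comp (continuous_norm.pow 2).neg

/-- **Linear × Gaussian integrability on `ℝ³`**: `x ↦ ‖x‖ e^{−‖x‖²}` is integrable (dominated by
`(1 + ‖x‖) e^{−‖x‖²}`, `PineauVicol2026.integrable_one_add_norm_pow_mul_exp_neg_mul_sq`).
[folklore] -/
theorem firstMom_integrable_norm_mul_exp :
    Integrable (fun x : EuclideanSpace ℝ (Fin 3) => ‖x‖ * Real.exp (-‖x‖ ^ 2)) := by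
  have hg := PineauVicol2026.integrable_one_add_norm_pow_mul_exp_neg_mul_sq
    (E := EuclideanSpace ℝ (Fin 3)) (c := 1) one_pos 1
  refine hg.mono' (continuous_norm.mul firstMom_continuous_exp).aestronglyMeasurable
    (Eventually.of_forall fun x => ?_)
  rw [Real.norm_of_nonneg (by positivity), pow_one, neg_one_mul]
  exact mul_le_mul_of_nonneg_right (le_add_of_nonneg_left zero_le_one) (Real.exp_nonneg _)

/-- **The vector moment integrand is integrable**: for continuous `w` with `‖w x‖ ≤ M`,
`x ↦ (e^{−‖x‖²} ⟪b, w x⟫) • x` is integrable — it is continuous and dominated by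
`‖b‖ M ‖x‖ e^{−‖x‖²}` (Cauchy–Schwarz). [folklore] -/
theorem firstMom_integrable_smul (hw : Continuous w) (hM : ∀ x, ‖w x‖ ≤ M)
    (b : EuclideanSpace ℝ (Fin 3)) :
    Integrable (fun x => (Real.exp (-‖x‖ ^ 2) * ⟪b, w x⟫_ℝ) • x) volume := by
  have hM0 : 0 ≤ M := (norm_nonneg _).trans (hM 0)
  refine Integrable.mono' (firstMom_integrable_norm_mul_exp.const_mul (‖b‖ * M)) ?_
    (Eventually.of_forall fun x => ?_)
  · exact ((firstMom_continuous_exp.mul (continuous_const.inner hw)).smul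
      continuous_id).aestronglyMeasurable
  · rw [norm_smul, norm_mul, Real.norm_of_nonneg (Real.exp_nonneg _), Real.norm_eq_abs]
    calc Real.exp (-‖x‖ ^ 2) * |⟪b, w x⟫_ℝ| * ‖x‖
        ≤ Real.exp (-‖x‖ ^ 2) * (‖b‖ * M) * ‖x‖ := by
          gcongr
          exact (abs_real_inner_le_norm _ _).trans
            (mul_le_mul_of_nonneg_left (hM x) (norm_nonneg _))
      _ = ‖b‖ * M * (‖x‖ * Real.exp (-‖x‖ ^ 2)) := by ring

/-- **The scalar moment integrand is integrable**: `x ↦ e^{−‖x‖²} (⟪a, x⟫ ⟪b, w x⟫)` is the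
inner product of the constant `a` with the integrable vector integrand. [folklore] -/
theorem firstMom_integrable_mul (hw : Continuous w) (hM : ∀ x, ‖w x‖ ≤ M)
    (a b : EuclideanSpace ℝ (Fin 3)) :
    Integrable (fun x => Real.exp (-‖x‖ ^ 2) * (⟪a, x⟫_ℝ * ⟪b, w x⟫_ℝ)) volume := by
  refine (Integrable.const_inner (𝕜 := ℝ) a (firstMom_integrable_smul hw hM b)).congr
    (Eventually.of_forall fun x => ?_)
  simp only [real_inner_smul_right]
  ring

/-- **The weighted helicity-type integrand is integrable**: `x ↦ e^{−‖x‖²} ⟪x, w x⟫` is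
continuous and dominated by `M ‖x‖ e^{−‖x‖²}`. [folklore] -/
theorem firstMom_integrable_exp_mul_inner (hw : Continuous w) (hM : ∀ x, ‖w x‖ ≤ M) :
    Integrable (fun x => Real.exp (-‖x‖ ^ 2) * ⟪x, w x⟫_ℝ) volume := by
  have hM0 : 0 ≤ M := (norm_nonneg _).trans (hM 0)
  refine Integrable.mono' (firstMom_integrable_norm_mul_exp.const_mul M)
    (firstMom_continuous_exp.mul (continuous_id.inner hw)).aestronglyMeasurable
    (Eventually.of_forall fun x => ?_)
  rw [norm_mul, Real.norm_of_nonneg (Real.exp_nonneg _), Real.norm_eq_abs]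
  calc Real.exp (-‖x‖ ^ 2) * |⟪x, w x⟫_ℝ| ≤ Real.exp (-‖x‖ ^ 2) * (‖x‖ * M) := by
        gcongr
        exact (abs_real_inner_le_norm _ _).trans
          (mul_le_mul_of_nonneg_left (hM x) (norm_nonneg _))
    _ = M * (‖x‖ * Real.exp (-‖x‖ ^ 2)) := by ring

/-- **The moment operator represents the moment form**:
`⟪a, ∫ (e^{−‖x‖²} ⟪b, w x⟫) • x⟫ = ∫ e^{−‖x‖²} (⟪a, x⟫ ⟪b, w x⟫)` (the inner product with a
constant commutes with the Bochner integral). [folklore] -/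
theorem firstMom_inner_integral (hw : Continuous w) (hM : ∀ x, ‖w x‖ ≤ M)
    (a b : EuclideanSpace ℝ (Fin 3)) :
    ⟪a, ∫ x, (Real.exp (-‖x‖ ^ 2) * ⟪b, w x⟫_ℝ) • x⟫_ℝ =
      ∫ x, Real.exp (-‖x‖ ^ 2) * (⟪a, x⟫_ℝ * ⟪b, w x⟫_ℝ) := by
  rw [← integral_inner (𝕜 := ℝ) (firstMom_integrable_smul hw hM b) a]
  refine integral_congr_ae (Eventually.of_forall fun x => ?_)
  simp only [real_inner_smul_right]
  ring

/-- **The moment operator is an intertwiner**: if `w (g x) = g (w x)` for a linear isometry `g` of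
`ℝ³`, then `∫ (e^{−‖x‖²} ⟪g v, w x⟫) • x = g (∫ (e^{−‖x‖²} ⟪v, w x⟫) • x)` — change variables
`x = g y` (`g` preserves Lebesgue measure), use `‖g y‖ = ‖y‖`, `⟪g v, g (w y)⟫ = ⟪v, w y⟫`, and
pull the isometry `g` out of the Bochner integral. [folklore] -/
theorem firstMom_integral_map
    (g : EuclideanSpace ℝ (Fin 3) ≃ₗᵢ[ℝ] EuclideanSpace ℝ (Fin 3)) (hwg : ∀ x, w (g x) = g (w x))
    (v : EuclideanSpace ℝ (Fin 3)) :
    ∫ x, (Real.exp (-‖x‖ ^ 2) * ⟪g v, w x⟫_ℝ) • x =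
      g (∫ x, (Real.exp (-‖x‖ ^ 2) * ⟪v, w x⟫_ℝ) • x) := by
  have h1 : ∫ y, (Real.exp (-‖g y‖ ^ 2) * ⟪g v, w (g y)⟫_ℝ) • g y =
      ∫ x, (Real.exp (-‖x‖ ^ 2) * ⟪g v, w x⟫_ℝ) • x :=
    g.measurePreserving.integral_comp g.toHomeomorph.measurableEmbedding
      (fun x => (Real.exp (-‖x‖ ^ 2) * ⟪g v, w x⟫_ℝ) • x)
  rw [← h1]
  simp_rw [hwg, LinearIsometryEquiv.norm_map, LinearIsometryEquiv.inner_map_map,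
    ← LinearIsometryEquiv.map_smul]
  rw [← LinearIsometryEquiv.coe_toContinuousLinearEquiv, ContinuousLinearEquiv.integral_comp_comm]

/-- **The moment form is a linear operator**: there is a linear map `T` of `ℝ³` with
`T b = ∫ (e^{−‖x‖²} ⟪b, w x⟫) • x` (additivity and homogeneity of the Bochner integral on
integrable integrands). [folklore] -/
theorem firstMom_exists_linearMap (hw : Continuous w) (hM : ∀ x, ‖w x‖ ≤ M) :
    ∃ T : EuclideanSpace ℝ (Fin 3) →ₗ[ℝ] EuclideanSpace ℝ (Fin 3),
      ∀ b, T b = ∫ x, (Real.exp (-‖x‖ ^ 2) * ⟪b, w x⟫_ℝ) • x := by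
  refine ⟨{ toFun := fun b => ∫ x, (Real.exp (-‖x‖ ^ 2) * ⟪b, w x⟫_ℝ) • x
            map_add' := fun b c => ?_
            map_smul' := fun c b => ?_ }, fun b => rfl⟩
  · simp only [inner_add_left, mul_add, add_smul]
    exact integral_add (firstMom_integrable_smul hw hM b) (firstMom_integrable_smul hw hM c)
  · simp only [real_inner_smul_left, RingHom.id_apply, ← integral_smul, smul_smul]
    exact integral_congr_ae (Eventually.of_forall fun x => by
      simp only [mul_left_comm (Real.exp (-‖x‖ ^ 2)) c])

/-- **The trace of the moment form**: summing the diagonal first moments over the standard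
orthonormal basis of `ℝ³` gives `∫ e^{−‖x‖²} ⟪x, w x⟫`
(`∑ i, ⟪x, e i⟫ ⟪e i, u⟫ = ⟪x, u⟫` under the integral sign). [folklore] -/
theorem firstMom_sum_diag (hw : Continuous w) (hM : ∀ x, ‖w x‖ ≤ M) :
    ∑ i, ∫ x, Real.exp (-‖x‖ ^ 2) * (⟪EuclideanSpace.basisFun (Fin 3) ℝ i, x⟫_ℝ *
        ⟪EuclideanSpace.basisFun (Fin 3) ℝ i, w x⟫_ℝ) =
      ∫ x, Real.exp (-‖x‖ ^ 2) * ⟪x, w x⟫_ℝ := by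
  rw [← integral_finsetSum _ fun i _ => firstMom_integrable_mul hw hM _ _]
  refine integral_congr_ae (Eventually.of_forall fun x => ?_)
  simp only
  rw [← Finset.mul_sum, ← (EuclideanSpace.basisFun (Fin 3) ℝ).sum_inner_mul_inner x (w x)]
  congr 1
  exact Finset.sum_congr rfl fun i _ => by rw [real_inner_comm x]

/-- **The Gaussian-weighted `∫ e^{−‖x‖²} ⟪x, w x⟫` vanishes for bounded divergence-free `C¹`
fields** (whole-space integration by parts in `L¹` form: `e^{−‖x‖²} x = −½ ∇e^{−‖x‖²}`, so
`∫ e^{−‖x‖²} ⟪x, w⟫ = −½ ∫ ⟪w, ∇e^{−‖x‖²}⟫ = ½ ∫ e^{−‖x‖²} div w = 0`; only `e^{−‖x‖²} w`,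
`⟪w, ∇e^{−‖x‖²}⟫` (bounded × linear × Gaussian) and `e^{−‖x‖²} div w = 0` need be integrable).
[folklore] -/
theorem firstMom_integral_exp_mul_inner_eq_zero (hw : ContDiff ℝ 1 w)
    (hdiv : VectorCalculus.IsDivFree w) (hM : ∀ x, ‖w x‖ ≤ M) :
    ∫ x, Real.exp (-‖x‖ ^ 2) * ⟪x, w x⟫_ℝ = 0 := by
  have hM0 : 0 ≤ M := (norm_nonneg _).trans (hM 0)
  have hg0 : ∀ x : EuclideanSpace ℝ (Fin 3), 0 ≤ gaussProfile (-1 : ℝ) x := fun x =>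
    Real.exp_nonneg _
  -- the gradient of the weight paired with `w`
  have hgrad : ∀ x, ⟪w x, gradient (gaussProfile (-1 : ℝ)) x⟫_ℝ =
      -2 * (Real.exp (-‖x‖ ^ 2) * ⟪x, w x⟫_ℝ) := fun x => by
    rw [real_inner_comm, gradient, InnerProductSpace.toDual_symm_apply, fderiv_gaussProfile_apply]
    simp only [gaussProfile, neg_one_mul]
    ring
  -- integrability of the three pieces
  have hint : Integrable (fun x => gaussProfile (-1 : ℝ) x • w x) volume := by
    refine Integrable.mono' ((PineauVicol2026.integrable_exp_neg_mul_sq_norm'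
      (E := EuclideanSpace ℝ (Fin 3)) one_pos).const_mul M)
      ((contDiff_gaussProfile (-1 : ℝ) (n := 0)).continuous.smul hw.continuous).aestronglyMeasurable
      (Eventually.of_forall fun x => ?_)
    rw [norm_smul, Real.norm_of_nonneg (hg0 x), mul_comm]
    exact mul_le_mul_of_nonneg_right (hM x) (hg0 x)
  have h₁ : Integrable (fun x => gaussProfile (-1 : ℝ) x * VectorCalculus.divergence w x) volume := by
    simp only [hdiv _, mul_zero]
    exact integrable_zero _ _ _
  have h₂ : Integrable (fun x => ⟪w x, gradient (gaussProfile (-1 : ℝ)) x⟫_ℝ) volume := by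
    simp_rw [hgrad]
    exact (firstMom_integrable_exp_mul_inner hw.continuous hM).const_mul (-2)
  -- integration by parts on the whole space
  have h := integral_mul_divergence_add_eq_zero_of_integrable
    (contDiff_gaussProfile (-1 : ℝ) (n := 1)) hw hint h₁ h₂
  simp_rw [hdiv _, mul_zero, integral_zero, zero_add, hgrad, integral_const_mul] at h
  linarith

/-- **Stub N16: the Gaussian first moments vanish (Schur on `ℝ³ ⊗ ℝ³`).** If `G` acts
irreducibly on `ℝ³` (every `G`-invariant subspace is `⊥` or `⊤`) and `w : ℝ³ → ℝ³` is `C¹`,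
divergence free, `G`-equivariant and bounded, then `∫ e^{−‖x‖²} ⟪a, x⟫ ⟪b, w x⟫ = 0` for all
`a b`: the moment operator `T b = ∫ (e^{−‖x‖²} ⟪b, w x⟫) • x` is a `G`-intertwiner whose trace
`∫ e^{−‖x‖²} ⟪x, w x⟫ = ½ ∫ e^{−‖x‖²} div w` vanishes (whole-space integration by parts), hence
`T = 0` by the real Schur lemma in trace-free form (`schurJet_eq_zero_of_comm_of_trace_eq_zero`).
For a witness of the crux this kills every first Gaussian moment of every slice of the
Oseen-gauge representative. [cite: SerreLinearRepresentations1977, §13.2 (real Schur lemma)] -/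
theorem stub_firstMomentsVanish :
    ∀ (G : Subgroup (EuclideanSpace ℝ (Fin 3) ≃ₗᵢ[ℝ] EuclideanSpace ℝ (Fin 3))),
      (∀ W : Submodule ℝ (EuclideanSpace ℝ (Fin 3)), (∀ g ∈ G, ∀ v ∈ W, g v ∈ W) → W = ⊥ ∨ W = ⊤) →
      ∀ (w : EuclideanSpace ℝ (Fin 3) → EuclideanSpace ℝ (Fin 3)), ContDiff ℝ 1 w → VectorCalculus.IsDivFree w →
        (∀ g ∈ G, ∀ x, w (g x) = g (w x)) → (∃ M : ℝ, ∀ x, ‖w x‖ ≤ M) →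
        ∀ a b : EuclideanSpace ℝ (Fin 3), ∫ x, Real.exp (-‖x‖ ^ 2) * (⟪a, x⟫_ℝ * ⟪b, w x⟫_ℝ) = 0 := by
  intro G hirr w hw hdiv hequiv hbdd a b
  obtain ⟨M, hM⟩ := hbdd
  have hwc : Continuous w := hw.continuous
  obtain ⟨T, hT⟩ := firstMom_exists_linearMap hwc hM
  -- `T` represents the moment form
  have hkey : ∀ a b, ⟪a, T b⟫_ℝ = ∫ x, Real.exp (-‖x‖ ^ 2) * (⟪a, x⟫_ℝ * ⟪b, w x⟫_ℝ) :=
    fun a b => by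
      rw [hT]
      exact firstMom_inner_integral hwc hM a b
  -- `T` commutes with `G`
  have hcomm : ∀ g ∈ G, ∀ v, T (g v) = g (T v) := fun g hg v => by
    rw [hT, hT]
    exact firstMom_integral_map g (hequiv g hg) v
  -- `T` is trace free: its trace is `∫ e^{−‖x‖²} ⟪x, w x⟫ = 0`
  have htr : LinearMap.trace ℝ (EuclideanSpace ℝ (Fin 3)) T = 0 := by
    rw [LinearMap.trace_eq_sum_inner T (EuclideanSpace.basisFun (Fin 3) ℝ)]
    simp_rw [hkey]
    rw [firstMom_sum_diag hwc hM, firstMom_integral_exp_mul_inner_eq_zero hw hdiv hM]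
  -- Schur: `T = 0`
  have h0 : T = 0 := schurJet_eq_zero_of_comm_of_trace_eq_zero hirr hcomm htr
  rw [← hkey, h0, LinearMap.zero_apply, inner_zero_right]

end Summit.NavierStokesRegularity.NavierStokesRegularity.Theorems.PolyhedralDssProfileExists.PolyhedralCell
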